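import Mathlib.Data.Nat.Choose.Basic
import Mathlib.Algebra.BigOperators.Intervals
import Mathlib.Algebra.Order.BigOperators.Group.Finset
import Mathlib.Tactic
import Summits.CriticalPhenomena.PercolationContinuityZ3.Theorems.PercNearOneGluingNoHeavyLowerTailHypergeomPeak
import HarnessLib

/-!
# One-block estimates (B1) of the CORE-LEMMA proof: a symmetric-unimodal tilt of fair coins

Support file for the Sahi / Conjecture-P programme of route `PercNearOneGluingNoHeavy`
(`--supports stmt-CriticalPhenomena-4575`, prover prim-l12-p5 gen 27; proof notes
`prim-l12-p5/CORE-g26.md` §5.2–5.4 and `prim-l12-p5/PROOF-DF1-g26.md` §3.2–3.4).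
No definitions, no named facts, no sorries.

Setting.  A BLOCK is a triple `(M, L, w)`: `M` fair coins of the first kind, `L` fair coins of the
second kind ('own buffer'), and a weight `w : {0..M} → ℝ` on the number `x` of heads of the first kind,
symmetric about `M/2` and unimodal.  Writing `G(L,k,x) = C(L,k-x)` (read as `0` for `x > k`) the two
block sums at total head count `k` are
* `F(k)  = ∑_{x ≤ M} C(M,x) G(L,k,x) w(x)`            (the tilted weight of `{total = k}`),
* `Mo(k) = ∑_{x ≤ M} C(M,x) G(L,k,x) w(x) (2x - M)`    (twice the centred first moment of `x` on it).
In the CORE-LEMMA proof (note §5.2, block `b`): `M = u_b + 1`, `L = h_b + s - 1`, `w(x) = C(h_b, m_b - x)`,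
`n_b + s = M + L`, and `Mo/F = 2·m_b` is (twice) the conditional centred mean of the hit count.
This file proves the one-block facts used there, all with the sums written out explicitly:

* `guard_reflect`, `F_symm`, `Mo_odd` : reflection `k ↦ M+L-k` (symmetry of `F`, oddness of `Mo`);
* `guard_le_of_closer`, `Mo_nonneg` : `Mo(k) ≥ 0` above the centre (`M+L ≤ 2k`), by pairing `x ↔ M-x`;
* `moment_absorb`, `F_pascal`, `Mo_upper` : the upper bound `(M+L)·Mo(k) ≤ (2k-M-L)·M·F(k)` above
  the centre — step (B1) of the note — reduced to `HypergeomPeak.ext_lemma_phi_mono` (EXTENDED LEMMA Φ)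
  for the block with one buffer coin removed;
* `F_nonneg`, `F_eq_zero_of_lt`, `Mo_eq_zero_of_lt` : positivity and support.
-/

namespace Summit.CriticalPhenomena.PercolationContinuityZ3.Theorems

namespace CoreBlock

open Finset

/-! ### The guarded buffer factor `G(L,k,x) = C(L,k-x)` -/

/-- Reflection of the guarded buffer factor: for `x ≤ M` and `k ≤ M+L`,
`G(L, M+L-k, M-x) = G(L, k, x)`. -/
theorem guard_reflect (M L k x : ℕ) (hx : x ≤ M) (hk : k ≤ M + L) :
    (if M - x ≤ M + L - k then (L.choose (M + L - k - (M - x)) : ℝ) else 0) =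
      (if x ≤ k then (L.choose (k - x) : ℝ) else 0) := by
  by_cases hxk : x ≤ k
  · rw [if_pos hxk]
    by_cases hkx : k - x ≤ L
    · rw [if_pos (by omega)]
      have e : M + L - k - (M - x) = L - (k - x) := by omega
      rw [e, Nat.choose_symm hkx]
    · rw [Nat.choose_eq_zero_of_lt (show L < k - x by omega)]
      by_cases hg : M - x ≤ M + L - k
      · rw [if_pos hg]
        exfalso
        omega
      · rw [if_neg hg]
        simp
  · rw [if_neg hxk, if_pos (by omega)]
    have hz : L < M + L - k - (M - x) := by omega
    simp [Nat.choose_eq_zero_of_lt hz]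

/-- Of two first-kind head counts `y ≤ x` with `L + ... ≤ 2k` (precisely `x + y + L ≤ 2k`), the larger
one has the larger buffer factor: `G(L,k,y) ≤ G(L,k,x)` (the index `k-x` is at least as close to `L/2`). -/
theorem guard_le_of_closer (L k x y : ℕ) (hyx : y ≤ x) (h : x + y + L ≤ 2 * k) :
    (if y ≤ k then (L.choose (k - y) : ℝ) else 0) ≤
      (if x ≤ k then (L.choose (k - x) : ℝ) else 0) := by
  by_cases hxk : x ≤ k
  · rw [if_pos hxk, if_pos (le_trans hyx hxk)]
    exact_mod_cast HypergeomPeak.choose_le_choose_of_closer (L := L) (p₁ := k - x) (p₂ := k - y)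
      (by omega) (by omega)
  · rw [if_neg hxk]
    by_cases hyk : y ≤ k
    · rw [if_pos hyk]
      have hz : L < k - y := by omega
      simp [Nat.choose_eq_zero_of_lt hz]
    · rw [if_neg hyk]

/-! ### Reflection: symmetry of `F`, oddness of `Mo` -/

variable (M L : ℕ) (w : ℕ → ℝ)

/-- Symmetry of the block weight: `F(M+L-k) = F(k)` for `k ≤ M+L`, `w` symmetric. -/
theorem F_symm (hwsym : ∀ x, x ≤ M → w x = w (M - x)) (k : ℕ) (hk : k ≤ M + L) :
    ∑ x ∈ range (M + 1), (M.choose x : ℝ) *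
        (if x ≤ M + L - k then (L.choose (M + L - k - x) : ℝ) else 0) * w x =
      ∑ x ∈ range (M + 1), (M.choose x : ℝ) *
        (if x ≤ k then (L.choose (k - x) : ℝ) else 0) * w x := by
  rw [← sum_range_reflect (fun x => (M.choose x : ℝ) *
        (if x ≤ M + L - k then (L.choose (M + L - k - x) : ℝ) else 0) * w x) (M + 1)]
  refine sum_congr rfl fun x hx => ?_
  have hxM : x ≤ M := by
    have := mem_range.mp hx
    omega
  have e0 : M + 1 - 1 - x = M - x := by omega
  simp only [e0]
  rw [Nat.choose_symm hxM, guard_reflect M L k x hxM hk, ← hwsym x hxM]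

/-- Oddness of the block moment: `Mo(M+L-k) = -Mo(k)` for `k ≤ M+L`, `w` symmetric. -/
theorem Mo_odd (hwsym : ∀ x, x ≤ M → w x = w (M - x)) (k : ℕ) (hk : k ≤ M + L) :
    ∑ x ∈ range (M + 1), (M.choose x : ℝ) *
        (if x ≤ M + L - k then (L.choose (M + L - k - x) : ℝ) else 0) * w x * (2 * (x : ℝ) - M) =
      -∑ x ∈ range (M + 1), (M.choose x : ℝ) *
        (if x ≤ k then (L.choose (k - x) : ℝ) else 0) * w x * (2 * (x : ℝ) - M) := by
  rw [← sum_range_reflect (fun x => (M.choose x : ℝ) *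
        (if x ≤ M + L - k then (L.choose (M + L - k - x) : ℝ) else 0) * w x * (2 * (x : ℝ) - M))
        (M + 1)]
  rw [← sum_neg_distrib]
  refine sum_congr rfl fun x hx => ?_
  have hxM : x ≤ M := by
    have := mem_range.mp hx
    omega
  have e0 : M + 1 - 1 - x = M - x := by omega
  simp only [e0]
  rw [Nat.choose_symm hxM, guard_reflect M L k x hxM hk, ← hwsym x hxM]
  push_cast [Nat.cast_sub hxM]
  ring

/-! ### Sign of `Mo` above the centre -/

/-- Above the centre (`M + L ≤ 2k`) the block moment is nonnegative:
`0 ≤ Mo(k)` for `w ≥ 0` symmetric.  (Pair `x` with `M-x`: the two terms carry opposite factors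
`±(2x-M)` and the one with the larger `x` has the larger buffer factor, `guard_le_of_closer`.) -/
theorem Mo_nonneg (hwsym : ∀ x, x ≤ M → w x = w (M - x)) (hwpos : ∀ x, 0 ≤ w x) (k : ℕ)
    (hk : M + L ≤ 2 * k) :
    0 ≤ ∑ x ∈ range (M + 1), (M.choose x : ℝ) *
        (if x ≤ k then (L.choose (k - x) : ℝ) else 0) * w x * (2 * (x : ℝ) - M) := by
  set G : ℕ → ℝ := fun x => if x ≤ k then (L.choose (k - x) : ℝ) else 0 with hGdef
  -- the reflected copy of the sum
  have hS : ∑ x ∈ range (M + 1), (M.choose x : ℝ) * G x * w x * (2 * (x : ℝ) - M) =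
      ∑ x ∈ range (M + 1), (M.choose x : ℝ) * G (M - x) * w x * ((M : ℝ) - 2 * x) := by
    rw [← sum_range_reflect (fun x => (M.choose x : ℝ) * G x * w x * (2 * (x : ℝ) - M)) (M + 1)]
    refine sum_congr rfl fun x hx => ?_
    have hxM : x ≤ M := by
      have := mem_range.mp hx
      omega
    have e0 : M + 1 - 1 - x = M - x := by omega
    simp only [e0]
    rw [Nat.choose_symm hxM, ← hwsym x hxM]
    push_cast [Nat.cast_sub hxM]
    ring
  -- twice the sum is a sum of nonnegative terms
  have h2 : (∑ x ∈ range (M + 1), (M.choose x : ℝ) * G x * w x * (2 * (x : ℝ) - M)) +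
      ∑ x ∈ range (M + 1), (M.choose x : ℝ) * G x * w x * (2 * (x : ℝ) - M) =
      ∑ x ∈ range (M + 1), (M.choose x : ℝ) * w x * ((2 * (x : ℝ) - M) * (G x - G (M - x))) := by
    nth_rewrite 2 [hS]
    rw [← sum_add_distrib]
    refine sum_congr rfl fun x _ => ?_
    ring
  have hterm : ∀ x ∈ range (M + 1),
      0 ≤ (M.choose x : ℝ) * w x * ((2 * (x : ℝ) - M) * (G x - G (M - x))) := by
    intro x hx
    have hxM : x ≤ M := by
      have := mem_range.mp hx
      omega
    refine mul_nonneg (mul_nonneg (by positivity) (hwpos x)) ?_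
    rcases le_or_gt (2 * x) M with hle | hgt
    · -- lower half: factor ≤ 0 and G x ≤ G (M-x)
      have hG : G x ≤ G (M - x) := by
        simp only [hGdef]
        exact guard_le_of_closer L k (M - x) x (by omega) (by omega)
      have hf : 2 * (x : ℝ) - M ≤ 0 := by
        have : (2 * x : ℝ) ≤ (M : ℝ) := by exact_mod_cast hle
        linarith
      exact mul_nonneg_of_nonpos_of_nonpos hf (sub_nonpos.mpr hG)
    · -- upper half: factor ≥ 0 and G (M-x) ≤ G x
      have hG : G (M - x) ≤ G x := by
        simp only [hGdef]
        exact guard_le_of_closer L k x (M - x) (by omega) (by omega)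
      have hf : 0 ≤ 2 * (x : ℝ) - M := by
        have : (M : ℝ) ≤ (2 * x : ℝ) := by exact_mod_cast hgt.le
        linarith
      exact mul_nonneg hf (sub_nonneg.mpr hG)
  have := sum_nonneg hterm
  rw [← h2] at this
  linarith

/-! ### The upper bound (B1) -/

/-- Absorption of the factor `k - x` into the buffer: `(k-x)·C(L,k-x) = L·C(L-1,k-1-x)`, summed:
`∑ C(M,x) G(L,k,x) w(x) (k-x) = L · ∑ C(M,x) G(L-1,k-1,x) w(x)`. -/
theorem moment_absorb (k : ℕ) (hk : 1 ≤ k) :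
    ∑ x ∈ range (M + 1), (M.choose x : ℝ) *
        (if x ≤ k then (L.choose (k - x) : ℝ) else 0) * w x * ((k : ℝ) - x) =
      (L : ℝ) * ∑ x ∈ range (M + 1), (M.choose x : ℝ) *
        (if x ≤ k - 1 then ((L - 1).choose (k - 1 - x) : ℝ) else 0) * w x := by
  rw [mul_sum]
  refine sum_congr rfl fun x _ => ?_
  -- the scalar identity `(k-x)·G(L,k,x) = L·G(L-1,k-1,x)`
  have key : (if x ≤ k then (L.choose (k - x) : ℝ) else 0) * ((k : ℝ) - x) =
      (L : ℝ) * (if x ≤ k - 1 then ((L - 1).choose (k - 1 - x) : ℝ) else 0) := by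
    rcases Nat.lt_or_ge x k with hlt | hge
    · -- x < k: genuine absorption identity
      rw [if_pos hlt.le, if_pos (by omega)]
      rcases Nat.eq_zero_or_pos L with hL | hL
      · subst hL
        have hz : (0 : ℕ).choose (k - x) = 0 := Nat.choose_eq_zero_of_lt (by omega)
        simp [hz]
      · obtain ⟨L', rfl⟩ : ∃ L', L = L' + 1 := ⟨L - 1, by omega⟩
        have h := Nat.add_one_mul_choose_eq L' (k - 1 - x)
        -- (L'+1) * C(L', k-1-x) = C(L'+1, k-1-x+1) * (k-1-x+1)
        have e1 : k - 1 - x + 1 = k - x := by omega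
        rw [e1] at h
        have hcast : (((L' + 1) * L'.choose (k - 1 - x) : ℕ) : ℝ) =
            (((L' + 1).choose (k - x) * (k - x) : ℕ) : ℝ) := by
          rw [h]
        push_cast [Nat.cast_sub hlt.le] at hcast
        have e2 : L' + 1 - 1 = L' := by omega
        rw [e2]
        push_cast
        linarith
    · -- x ≥ k: both sides vanish
      by_cases hxk : x ≤ k
      · have hx : x = k := le_antisymm hxk hge
        subst hx
        rw [if_pos le_rfl, if_neg (show ¬ (x ≤ x - 1) by omega)]
        simp
      · rw [if_neg hxk, if_neg (show ¬ (x ≤ k - 1) by omega)]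
        simp
  calc (M.choose x : ℝ) * (if x ≤ k then (L.choose (k - x) : ℝ) else 0) * w x * ((k : ℝ) - x)
      = (M.choose x : ℝ) * w x *
          ((if x ≤ k then (L.choose (k - x) : ℝ) else 0) * ((k : ℝ) - x)) := by ring
    _ = (M.choose x : ℝ) * w x *
          ((L : ℝ) * (if x ≤ k - 1 then ((L - 1).choose (k - 1 - x) : ℝ) else 0)) := by rw [key]
    _ = (L : ℝ) * ((M.choose x : ℝ) *
          (if x ≤ k - 1 then ((L - 1).choose (k - 1 - x) : ℝ) else 0) * w x) := by ring

/-- Pascal on the buffer: for `L = L'+1` and `k ≥ 1`,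
`F_{L'+1}(k) = P(k) + P(k-1)` with `P(κ) = ∑ C(M,x) G(L',κ,x) w(x)`. -/
theorem F_pascal (L' k : ℕ) (hk : 1 ≤ k) :
    ∑ x ∈ range (M + 1), (M.choose x : ℝ) *
        (if x ≤ k then ((L' + 1).choose (k - x) : ℝ) else 0) * w x =
      (∑ x ∈ range (M + 1), (M.choose x : ℝ) *
        (if x ≤ k then (L'.choose (k - x) : ℝ) else 0) * w x) +
      ∑ x ∈ range (M + 1), (M.choose x : ℝ) *
        (if x ≤ k - 1 then (L'.choose (k - 1 - x) : ℝ) else 0) * w x := by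
  rw [← sum_add_distrib]
  refine sum_congr rfl fun x _ => ?_
  have key : (if x ≤ k then ((L' + 1).choose (k - x) : ℝ) else 0) =
      (if x ≤ k then (L'.choose (k - x) : ℝ) else 0) +
        (if x ≤ k - 1 then (L'.choose (k - 1 - x) : ℝ) else 0) := by
    rcases Nat.lt_or_ge x k with hlt | hge
    · rw [if_pos hlt.le, if_pos hlt.le, if_pos (by omega)]
      have e : k - x = (k - 1 - x) + 1 := by omega
      rw [e, Nat.choose_succ_succ']
      push_cast
      ring
    · by_cases hxk : x ≤ k
      · have hx : x = k := le_antisymm hxk hge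
        subst hx
        rw [if_pos le_rfl, if_pos le_rfl, if_neg (by omega)]
        simp
      · rw [if_neg hxk, if_neg hxk, if_neg (by omega)]
        simp
  rw [key]
  ring

/-- **Step (B1) of the note (upper bound).**  Above the centre, `M + L ≤ 2k`, for `w` symmetric and
unimodal: `(M+L)·Mo(k) ≤ (2k-M-L)·M·F(k)`, i.e. the conditional centred mean of the first-kind head
count is at most its 'fair share' `(k-(M+L)/2)·M/(M+L)` of the total excess.  Reduced to EXTENDED
LEMMA Φ (`HypergeomPeak.ext_lemma_phi_mono`) for the block with one buffer coin split off. -/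
theorem Mo_upper (hwsym : ∀ x, x ≤ M → w x = w (M - x))
    (hwuni : ∀ x, 2 * x + 2 ≤ M → w x ≤ w (x + 1)) (k : ℕ) (hk : M + L ≤ 2 * k) :
    ((M : ℝ) + L) * ∑ x ∈ range (M + 1), (M.choose x : ℝ) *
        (if x ≤ k then (L.choose (k - x) : ℝ) else 0) * w x * (2 * (x : ℝ) - M) ≤
      (2 * (k : ℝ) - M - L) * M * ∑ x ∈ range (M + 1), (M.choose x : ℝ) *
        (if x ≤ k then (L.choose (k - x) : ℝ) else 0) * w x := by
  rcases Nat.eq_zero_or_pos k with hk0 | hkpos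
  · -- k = 0 forces M = L = 0: both sides vanish
    subst hk0
    have hM : M = 0 := by omega
    have hL : L = 0 := by omega
    subst hM
    subst hL
    simp
  -- F and the first moment
  set F : ℝ := ∑ x ∈ range (M + 1), (M.choose x : ℝ) *
        (if x ≤ k then (L.choose (k - x) : ℝ) else 0) * w x with hFdef
  set P : ℝ := ∑ x ∈ range (M + 1), (M.choose x : ℝ) *
        (if x ≤ k - 1 then ((L - 1).choose (k - 1 - x) : ℝ) else 0) * w x with hPdef
  -- Mo = (2k - M) F - 2 L P
  have hMo : ∑ x ∈ range (M + 1), (M.choose x : ℝ) *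
        (if x ≤ k then (L.choose (k - x) : ℝ) else 0) * w x * (2 * (x : ℝ) - M) =
      (2 * (k : ℝ) - M) * F - 2 * ((L : ℝ) * P) := by
    rw [hPdef, ← moment_absorb M L w k hkpos, hFdef, mul_sum, mul_sum, ← sum_sub_distrib]
    refine sum_congr rfl fun x _ => ?_
    ring
  rw [hMo]
  rcases Nat.eq_zero_or_pos L with hL | hL
  · -- no buffer: equality
    subst hL
    push_cast
    nlinarith [sq_nonneg F, sq_nonneg P]
  · -- L = L' + 1: Pascal and EXTENDED LEMMA Φ for the block (M, L') at k-1
    obtain ⟨L', rfl⟩ : ∃ L', L = L' + 1 := ⟨L - 1, by omega⟩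
    obtain ⟨j, rfl⟩ : ∃ j, k = j + 1 := ⟨k - 1, by omega⟩
    have eL : L' + 1 - 1 = L' := by omega
    have ej : j + 1 - 1 = j := by omega
    -- P = ∑ C(M,x) G(L',j,x) w
    have hP : P = ∑ x ∈ range (M + 1), (M.choose x : ℝ) *
        (if x ≤ j then (L'.choose (j - x) : ℝ) else 0) * w x := by
      rw [hPdef]
      simp only [eL, ej]
    -- F = Q + P with Q = ∑ C(M,x) G(L',j+1,x) w
    set Q : ℝ := ∑ x ∈ range (M + 1), (M.choose x : ℝ) *
        (if x ≤ j + 1 then (L'.choose (j + 1 - x) : ℝ) else 0) * w x with hQdef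
    have hF : F = Q + P := by
      rw [hFdef, F_pascal M w L' (j + 1) (by omega), hQdef, hP]
      simp only [ej]
    -- EXTENDED LEMMA Φ: (j+1) Q ≤ (L' + M - j) P
    have hphi := HypergeomPeak.ext_lemma_phi_mono L' M j (by omega) w hwsym hwuni
    rw [← hQdef, ← hP] at hphi
    have key : 2 * ((L' : ℝ) + 1) * (((j : ℝ) + 1) * Q) ≤
        2 * ((L' : ℝ) + 1) * (((L' : ℝ) + M - j) * P) :=
      mul_le_mul_of_nonneg_left hphi (by positivity)
    rw [hF]
    push_cast
    nlinarith [key]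

/-! ### Positivity and support -/

/-- `F(k) ≥ 0` for `w ≥ 0`. -/
theorem F_nonneg (hwpos : ∀ x, 0 ≤ w x) (k : ℕ) :
    0 ≤ ∑ x ∈ range (M + 1), (M.choose x : ℝ) *
        (if x ≤ k then (L.choose (k - x) : ℝ) else 0) * w x := by
  refine sum_nonneg fun x _ => mul_nonneg (mul_nonneg (by positivity) ?_) (hwpos x)
  split_ifs <;> positivity

/-- Support: `F(k) = 0` for `k > M + L`. -/
theorem F_eq_zero_of_lt (k : ℕ) (hk : M + L < k) :
    ∑ x ∈ range (M + 1), (M.choose x : ℝ) *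
        (if x ≤ k then (L.choose (k - x) : ℝ) else 0) * w x = 0 := by
  refine sum_eq_zero fun x hx => ?_
  have hxM : x ≤ M := by
    have := mem_range.mp hx
    omega
  rw [if_pos (show x ≤ k by omega), Nat.choose_eq_zero_of_lt (show L < k - x by omega)]
  simp

/-- Support: `Mo(k) = 0` for `k > M + L`. -/
theorem Mo_eq_zero_of_lt (k : ℕ) (hk : M + L < k) :
    ∑ x ∈ range (M + 1), (M.choose x : ℝ) *
        (if x ≤ k then (L.choose (k - x) : ℝ) else 0) * w x * (2 * (x : ℝ) - M) = 0 := by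
  refine sum_eq_zero fun x hx => ?_
  have hxM : x ≤ M := by
    have := mem_range.mp hx
    omega
  rw [if_pos (show x ≤ k by omega), Nat.choose_eq_zero_of_lt (show L < k - x by omega)]
  simp

/-- The step inequality of EXTENDED LEMMA Φ in the present notation (a restatement of
`HypergeomPeak.ext_lemma_phi_mono`): `(k+1)·F(k+1) ≤ (M+L-k)·F(k)` for `M + L ≤ 2k+1`. -/
theorem F_step (hwsym : ∀ x, x ≤ M → w x = w (M - x))
    (hwuni : ∀ x, 2 * x + 2 ≤ M → w x ≤ w (x + 1)) (k : ℕ) (hk : M + L ≤ 2 * k + 1) :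
    ((k : ℝ) + 1) * ∑ x ∈ range (M + 1), (M.choose x : ℝ) *
        (if x ≤ k + 1 then (L.choose (k + 1 - x) : ℝ) else 0) * w x ≤
      ((M : ℝ) + L - k) * ∑ x ∈ range (M + 1), (M.choose x : ℝ) *
        (if x ≤ k then (L.choose (k - x) : ℝ) else 0) * w x := by
  have h := HypergeomPeak.ext_lemma_phi_mono L M k (by omega) w hwsym hwuni
  have e : ((L : ℝ) + M - k) = ((M : ℝ) + L - k) := by ring
  rw [e] at h
  exact h

end CoreBlock

end Summit.CriticalPhenomena.PercolationContinuityZ3.Theorems
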